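import Mathlib
import HarnessLib
import Summits.ValiantsHypothesis.ValiantsHypothesis.Theorems.LacunarySymmetroidMatrixDescartesProductPlusOneBalanceCount
import Summits.ValiantsHypothesis.ValiantsHypothesis.Theorems.LacunarySymmetroidMatrixDescartesProductPlusOneSharpCalculus

/-!
# ValiantsHypothesis / LacunarySymmetroid — crux `MatrixDescartes` (stmt-ValiantsHypothesis-18050, V1),
# LINE (A) «product_plus_one», floor `OneChangeFloorK3`: the RISER FLOOR and the MID-SWITCHING SECTOR (every support ratio)

Setting of the `K = 3` row at the bottom coupling (✓ `…UnswitchedWindow`, ✓ `…BalanceZone`, ✓ `…LateSwitching`): factors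
`g = a + b x^p + c x^q` (`p = e+1`, `q = e+k+2`), bottom-weight logarithmic derivative `Ψ = Σ_j (p b_j + q c_j x^{q−p})/g_j`, whose zeros off
the factors' zeros are the positive zeros of `eulerNumerator d a 0`; `num_j` = numerator of `Ψ_j′` (✓ `hasDerivAt_term`, ✓ `psi_numerator_eq`).
For an incoherent no-dip row (`(+,−,−)` up to sign) write `N = −θg = p|b|x^p + q|c|x^q` (its PULL numerator) and
`K(x) = θN/N = (p²|b|x^p + q²|c|x^q)/(p|b|x^p + q|c|x^q) ∈ (p, q)` (its CAPACITY: `θ(θg/g) = (θg/g)·(K − θg/g)`, the logistic Riccati law).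

* `young_trinomial_nonneg` — `p·y^q − q·y^p + (q − p) ≥ 0` for `y > 0` (weighted AM–GM; via ✓ `bernoulli_pow` / ✓ `bernoulli_inv_pow`);
* ★ `riserFloor_identity` / `riserFloor` — THE RISER FLOOR: if `g(ρ) = 0` then for EVERY `x > 0`
  `N(ρ)·N(x) + θN(ρ)·g(x) − N(ρ)² = (q−p)·bc·ρ^{p+q}·(p y^q − q y^p + (q−p))`, `y = x/ρ`, hence `≥ 0` for `bc ≥ 0`:
  past its zero a switched incoherent row satisfies `θg/g ≥ K(ρ) + N(ρ)/|g|` — «a riser's logarithmic derivative never falls below its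
  capacity AT BIRTH» (sharpens `θg/g > p`);
* ★ `numerator_neg_of_midSwitched` — consequently, if the row's zero `ρ` lies beyond its ENTRY HORIZON, `q·c²·ρ^{q−p} ≥ (q−2p)·bc`
  (⟺ `K(ρ) ≥ q − p`; in units `|b|/|c|`: `ρ^{q−p} ≥ (r−2)/r`, `r = q/p`), then `num < 0` at EVERY switched point: the row is `Ψ`-monotone in
  every phase — a FREE RIDER.  ✓ `…LateSwitching` needs `ρ^{q−p} ≥ (q−3p)|b|/(p|c|)` (`= r − 3` in the same units, the TOP of the balance
  zone); the entry horizon `(r−2)/r < 1` lies INSIDE the balance zone, a factor `r(r−3)/(r−2)` lower: rows switching anywhere in the upper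
  part of their balance zone are also harmless (mechanism: the capacity can rise by at most `q − K(ρ) ≤ p` after birth, so the row never lags
  its capacity by more than `p`);
* `hasDerivAt_psi_neg_of_num` / `psi_injective_of_num` / `X_mul_derivative_no_two_zeros_of_num` — the window law with the RAW pointwise
  hypothesis `num_j(t) < 0` (any future per-row criterion plugs in here);
* ★★ `eulerBound_midSwitching` — `K = 3`, bottom coupling, ANY support, any `m`: a no-dip company (`a_{j0}a_{j2} < 0`) in which every incoherent
  row is unswitched below its entry horizon (`(d₂−d₀)·a_{j2}²·x^{d₂−d₁} < (d₂−d₀−2(d₁−d₀))·a_{j1}a_{j2} ⇒ a_{j2}·f_j(x) < 0`) has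
  `Z₊(eulerNumerator d a 0) ≤ 2m + 1` — LINEAR IN `m`, NO RATIO WINDOW; `midSwitching_sector_class` — members `≤ 2m + 2`.

So at ratio `> 4` the floor's open core shrinks further: companies containing an incoherent row switching BEFORE its entry horizon
(`|c|ρ^{q−p} < ((q−2p)/q)|b|`: «early risers», the only rows that can ever lag their capacity by more than `p`).
HONEST FRAMING: a sector of the research floor + a row law; closes NO stub; NOT `OneChangeFloorK3` / `stub_eulerBoundK3` / `stub_classRowK3` /
`stub_polyLaw` / `MatrixDescartes`; `VP ≠ VNP` is NOT proved.  No definitions, no named facts, no sorry; Mathlib + the lane files.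

[folklore] Weighted AM–GM / Bernoulli and Rolle; no citation needed.
-/

set_option linter.dupNamespace false

namespace Summit.ValiantsHypothesis.ValiantsHypothesis.Theorems.LacunarySymmetroidMatrixDescartes

namespace ProductPlusOne

open Polynomial Finset
open scoped BigOperators

/-! ### §1 The Young trinomial -/

/-- **Young trinomial**: `(e+1)·y^{e+k+2} − (e+k+2)·y^{e+1} + (k+1) ≥ 0` for `y ≥ 0`... stated for `y > 0`
(weighted AM–GM of `y^{e+k+2}` and `1`). [folklore] -/
theorem young_trinomial_nonneg (e k : ℕ) {y : ℝ} (hy : 0 < y) :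
    0 ≤ (e + 1 : ℝ) * y ^ (e + k + 2) - (e + k + 2 : ℝ) * y ^ (e + 1) + (k + 1 : ℝ) := by
  have h1 := bernoulli_pow y hy.le (k + 1)
  have h2 := bernoulli_inv_pow y hy (e + 1)
  have hye : 0 < y ^ (e + 1) := pow_pos hy _
  have h2' : y ^ (e + 1) * (1 - ((e + 1 : ℕ) : ℝ) * (y - 1)) ≤ 1 := by
    have := mul_le_mul_of_nonneg_left h2 hye.le
    rwa [inv_pow, mul_inv_cancel₀ hye.ne'] at this
  have h1' : y ^ (e + 1) * (1 + ((k + 1 : ℕ) : ℝ) * (y - 1)) ≤ y ^ (e + 1) * y ^ (k + 1) :=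
    mul_le_mul_of_nonneg_left h1 hye.le
  have hpow : y ^ (e + k + 2) = y ^ (e + 1) * y ^ (k + 1) := by ring
  push_cast at h1' h2'
  rw [hpow]
  have hE : (0 : ℝ) ≤ (e + 1 : ℝ) := by positivity
  have hK : (0 : ℝ) ≤ (k + 1 : ℝ) := by positivity
  have h3 := mul_le_mul_of_nonneg_left h1' hE
  have h4 := mul_le_mul_of_nonneg_left h2' hK
  linarith

/-! ### §2 The riser floor -/

/-- **Riser-floor identity** (pure algebra): with `g(ρ) = 0`, `N(x) = −(p b x^p + q c x^q)`, `θN(ρ) = −(p² b ρ^p + q² c ρ^q)`: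
`N(ρ)·N(x) + θN(ρ)·g(x) − N(ρ)² = (q−p)·(bc)·(p ρ^p x^q − q ρ^q x^p + (q−p) ρ^p ρ^q)`. [folklore] -/
theorem riserFloor_identity (a b c : ℝ) (e k : ℕ) {ρ : ℝ} (hρ : a + b * ρ ^ (e + 1) + c * ρ ^ (e + k + 2) = 0) (x : ℝ) :
    (-((e + 1 : ℝ) * b * ρ ^ (e + 1) + (e + k + 2 : ℝ) * c * ρ ^ (e + k + 2)))
        * (-((e + 1 : ℝ) * b * x ^ (e + 1) + (e + k + 2 : ℝ) * c * x ^ (e + k + 2)))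
      + (-((e + 1 : ℝ) ^ 2 * b * ρ ^ (e + 1) + (e + k + 2 : ℝ) ^ 2 * c * ρ ^ (e + k + 2)))
        * (a + b * x ^ (e + 1) + c * x ^ (e + k + 2))
      - (-((e + 1 : ℝ) * b * ρ ^ (e + 1) + (e + k + 2 : ℝ) * c * ρ ^ (e + k + 2))) ^ 2
      = (k + 1 : ℝ) * (b * c) * ((e + 1 : ℝ) * ρ ^ (e + 1) * x ^ (e + k + 2)
          - (e + k + 2 : ℝ) * ρ ^ (e + k + 2) * x ^ (e + 1) + (k + 1 : ℝ) * ρ ^ (e + 1) * ρ ^ (e + k + 2)) := by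
  linear_combination (-((e + 1 : ℝ) ^ 2 * b * ρ ^ (e + 1) + (e + k + 2 : ℝ) ^ 2 * c * ρ ^ (e + k + 2))) * hρ

/-- The bracket of the floor identity is `ρ^{p+q}` times the Young trinomial at `y = x/ρ`, hence non-negative. [folklore] -/
theorem riserFloor_bracket_nonneg (e k : ℕ) {ρ x : ℝ} (hρ : 0 < ρ) (hx : 0 < x) :
    0 ≤ (e + 1 : ℝ) * ρ ^ (e + 1) * x ^ (e + k + 2)
        - (e + k + 2 : ℝ) * ρ ^ (e + k + 2) * x ^ (e + 1) + (k + 1 : ℝ) * ρ ^ (e + 1) * ρ ^ (e + k + 2) := by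
  have hy : 0 < x / ρ := div_pos hx hρ
  have h := young_trinomial_nonneg e k hy
  have hρpq : 0 < ρ ^ (e + 1) * ρ ^ (e + k + 2) := by positivity
  have hid : (e + 1 : ℝ) * ρ ^ (e + 1) * x ^ (e + k + 2)
        - (e + k + 2 : ℝ) * ρ ^ (e + k + 2) * x ^ (e + 1) + (k + 1 : ℝ) * ρ ^ (e + 1) * ρ ^ (e + k + 2)
      = (ρ ^ (e + 1) * ρ ^ (e + k + 2))
        * ((e + 1 : ℝ) * (x / ρ) ^ (e + k + 2) - (e + k + 2 : ℝ) * (x / ρ) ^ (e + 1) + (k + 1 : ℝ)) := by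
    rw [div_pow, div_pow]
    field_simp
  rw [hid]
  exact mul_nonneg hρpq.le h

/-- ★ **THE RISER FLOOR** (multiplied-out form): for a row with `b c ≥ 0` vanishing at `ρ > 0`, at every `x > 0`
`N(ρ)·N(x) + θN(ρ)·g(x) ≥ N(ρ)²`; for a switched incoherent row (`g(x)` opposite `a`) this reads `θg/g ≥ K(ρ) + N(ρ)/|g(x)|`,
`K(ρ) = θN(ρ)/N(ρ)` the capacity at birth. [this file's lemma] -/
theorem riserFloor (a b c : ℝ) (e k : ℕ) (hbc : 0 ≤ b * c) {ρ x : ℝ} (hρ : 0 < ρ) (hx : 0 < x)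
    (hg : a + b * ρ ^ (e + 1) + c * ρ ^ (e + k + 2) = 0) :
    (-((e + 1 : ℝ) * b * ρ ^ (e + 1) + (e + k + 2 : ℝ) * c * ρ ^ (e + k + 2))) ^ 2
      ≤ (-((e + 1 : ℝ) * b * ρ ^ (e + 1) + (e + k + 2 : ℝ) * c * ρ ^ (e + k + 2)))
          * (-((e + 1 : ℝ) * b * x ^ (e + 1) + (e + k + 2 : ℝ) * c * x ^ (e + k + 2)))
        + (-((e + 1 : ℝ) ^ 2 * b * ρ ^ (e + 1) + (e + k + 2 : ℝ) ^ 2 * c * ρ ^ (e + k + 2)))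
          * (a + b * x ^ (e + 1) + c * x ^ (e + k + 2)) := by
  have h := riserFloor_identity a b c e k hg x
  have hB := riserFloor_bracket_nonneg e k hρ hx
  have hk : (0 : ℝ) ≤ (k + 1 : ℝ) := by positivity
  have hprod := mul_nonneg (mul_nonneg hk hbc) hB
  linarith

/-! ### §3 Mid-switched rows are `Ψ`-monotone -/

/-- ★ **Mid-switched incoherent rows are `Ψ`-decreasing** (normalised signs `a > 0`, `b < 0`, `c < 0`): if the row vanishes at `ρ > 0` with
`q·c²·ρ^{q−p} ≥ (q−2p)·bc` (entry horizon passed at birth, `K(ρ) ≥ q−p`) and is switched at `x > 0` (`g(x) < 0`), then `num(x) < 0`.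
[this file's lemma] -/
theorem numerator_neg_of_midSwitched_pos (a b c : ℝ) (e k : ℕ) (hb : b < 0) (hc : c < 0) {ρ x : ℝ} (hρ : 0 < ρ) (hx : 0 < x)
    (hg : a + b * ρ ^ (e + 1) + c * ρ ^ (e + k + 2) = 0)
    (hthr : ((e + k + 2 : ℝ) - 2 * (e + 1 : ℝ)) * (b * c) ≤ (e + k + 2 : ℝ) * c ^ 2 * ρ ^ (k + 1))
    (hsw : a + b * x ^ (e + 1) + c * x ^ (e + k + 2) < 0) :
    ((e + k + 2 : ℝ) * c * ((k + 1 : ℝ) * x ^ k)) * (a + b * x ^ (e + 1) + c * x ^ (e + k + 2))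
        - ((e + 1 : ℝ) * b + (e + k + 2 : ℝ) * c * x ^ (k + 1))
          * (b * ((e + 1 : ℝ) * x ^ e) + c * ((e + k + 2 : ℝ) * x ^ (e + k + 1))) < 0 := by
  -- notation
  set g := a + b * x ^ (e + 1) + c * x ^ (e + k + 2) with hgdef
  set S := (e + 1 : ℝ) * b + (e + k + 2 : ℝ) * c * x ^ (k + 1) with hSdef
  set Nρ := -((e + 1 : ℝ) * b * ρ ^ (e + 1) + (e + k + 2 : ℝ) * c * ρ ^ (e + k + 2)) with hNρ
  set Tρ := -((e + 1 : ℝ) ^ 2 * b * ρ ^ (e + 1) + (e + k + 2 : ℝ) ^ 2 * c * ρ ^ (e + k + 2)) with hTρ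
  set Nx := -((e + 1 : ℝ) * b * x ^ (e + 1) + (e + k + 2 : ℝ) * c * x ^ (e + k + 2)) with hNx
  have hρp : 0 < ρ ^ (e + 1) := pow_pos hρ _
  have hρq : 0 < ρ ^ (e + k + 2) := pow_pos hρ _
  have hxp : 0 < x ^ (e + 1) := pow_pos hx _
  have hxk : 0 < x ^ (k + 1) := pow_pos hx _
  have hNρpos : 0 < Nρ := by
    rw [hNρ]; nlinarith [mul_pos_of_neg_of_neg hb (neg_neg_of_pos hρp), mul_pos_of_neg_of_neg hc (neg_neg_of_pos hρq)]
  -- threshold ⇒ `Tρ ≥ (k+1)·Nρ`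
  have hρsplit : ρ ^ (e + k + 2) = ρ ^ (e + 1) * ρ ^ (k + 1) := by ring
  -- `Tρ − (k+1)Nρ = (e+1)ρ^{e+1}((q−2p) b − q c ρ^{k+1})` and `c·((q−2p)b − q c ρ^{k+1}) ≤ 0` with `c < 0`
  have hcX : c * (((e + k + 2 : ℝ) - 2 * (e + 1 : ℝ)) * b - (e + k + 2 : ℝ) * c * ρ ^ (k + 1)) ≤ 0 := by
    have hid : c * (((e + k + 2 : ℝ) - 2 * (e + 1 : ℝ)) * b - (e + k + 2 : ℝ) * c * ρ ^ (k + 1))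
        = ((e + k + 2 : ℝ) - 2 * (e + 1 : ℝ)) * (b * c) - (e + k + 2 : ℝ) * c ^ 2 * ρ ^ (k + 1) := by ring
    rw [hid]; linarith
  have hcore : 0 ≤ ((e + k + 2 : ℝ) - 2 * (e + 1 : ℝ)) * b - (e + k + 2 : ℝ) * c * ρ ^ (k + 1) := by
    by_contra hlt
    have hlt' := lt_of_not_ge hlt
    have : 0 < c * (((e + k + 2 : ℝ) - 2 * (e + 1 : ℝ)) * b - (e + k + 2 : ℝ) * c * ρ ^ (k + 1)) :=
      mul_pos_of_neg_of_neg hc hlt'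
    linarith
  have hTN : (k + 1 : ℝ) * Nρ ≤ Tρ := by
    have hid : Tρ - (k + 1 : ℝ) * Nρ
        = ((e + 1 : ℝ) * ρ ^ (e + 1)) * (((e + k + 2 : ℝ) - 2 * (e + 1 : ℝ)) * b - (e + k + 2 : ℝ) * c * ρ ^ (k + 1)) := by
      rw [hTρ, hNρ, hρsplit]; ring
    have hnn : 0 ≤ ((e + 1 : ℝ) * ρ ^ (e + 1)) * (((e + k + 2 : ℝ) - 2 * (e + 1 : ℝ)) * b - (e + k + 2 : ℝ) * c * ρ ^ (k + 1)) :=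
      mul_nonneg (by positivity) hcore
    linarith
  -- the floor: `Nρ·Nx + Tρ·g ≥ Nρ²`
  have hfloor : Nρ ^ 2 ≤ Nρ * Nx + Tρ * g :=
    riserFloor a b c e k (mul_pos_of_neg_of_neg hb hc).le hρ hx hg
  -- `S < 0`, `Nx = −x^{e+1} S`
  have hS : S < 0 := by
    rw [hSdef]; nlinarith [mul_pos_of_neg_of_neg hc (neg_neg_of_pos hxk)]
  have hNxS : Nx = -(x ^ (e + 1) * S) := by
    rw [hNx, hSdef]; ring
  -- (**) `x^{e+1} S < (k+1) g`
  have hTρpos : 0 < Tρ := lt_of_lt_of_le (by positivity) hTN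
  have hstar : x ^ (e + 1) * S < (k + 1 : ℝ) * g := by
    -- from the floor: Nρ·Nx > −Tρ·g = Tρ·|g| ≥ (k+1)·Nρ·|g|
    have h1 : 0 < Nρ * Nx + Tρ * g := lt_of_lt_of_le (by positivity) hfloor
    have h2 : (k + 1 : ℝ) * Nρ * (-g) ≤ Tρ * (-g) := mul_le_mul_of_nonneg_right hTN (neg_nonneg.2 hsw.le)
    have h3 : Nρ * ((k + 1 : ℝ) * (-g)) < Nρ * Nx := by linarith
    have h4 : (k + 1 : ℝ) * (-g) < Nx := lt_of_mul_lt_mul_left h3 hNρpos.le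
    rw [hNxS] at h4
    linarith
  -- `μ < q − p`: `(e+k+2)(k+1) c x^{k+1} > (k+1) S`
  have hmu : (k + 1 : ℝ) * S < (e + k + 2 : ℝ) * ((k + 1 : ℝ) * x ^ (k + 1)) * c := by
    have hid : (e + k + 2 : ℝ) * ((k + 1 : ℝ) * x ^ (k + 1)) * c - (k + 1 : ℝ) * S = -((k + 1 : ℝ) * ((e + 1 : ℝ) * b)) := by
      rw [hSdef]; ring
    have : (k + 1 : ℝ) * ((e + 1 : ℝ) * b) < 0 :=
      mul_neg_of_pos_of_neg (by positivity) (mul_neg_of_pos_of_neg (by positivity) hb)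
    linarith
  -- assemble: `x·num = q(q−p)x^{k+1} c g − x^{e+1} S² < 0`
  have hnum_x : x * (((e + k + 2 : ℝ) * c * ((k + 1 : ℝ) * x ^ k)) * g
        - S * (b * ((e + 1 : ℝ) * x ^ e) + c * ((e + k + 2 : ℝ) * x ^ (e + k + 1))))
      = ((e + k + 2 : ℝ) * ((k + 1 : ℝ) * x ^ (k + 1)) * c) * g - (x ^ (e + 1) * S) * S := by
    rw [hSdef]; ring
  have hA : ((e + k + 2 : ℝ) * ((k + 1 : ℝ) * x ^ (k + 1)) * c) * g < ((k + 1 : ℝ) * S) * g :=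
    mul_lt_mul_of_neg_right hmu hsw
  have hB : ((k + 1 : ℝ) * g) * S < (x ^ (e + 1) * S) * S :=
    mul_lt_mul_of_neg_right hstar hS
  have hprod : x * (((e + k + 2 : ℝ) * c * ((k + 1 : ℝ) * x ^ k)) * g
        - S * (b * ((e + 1 : ℝ) * x ^ e) + c * ((e + k + 2 : ℝ) * x ^ (e + k + 1)))) < 0 := by
    rw [hnum_x]; linarith
  by_contra hge
  have hge' := le_of_not_gt hge
  have := mul_nonneg hx.le hge'
  linarith

/-- `num` is invariant under the global sign flip `(a,b,c) ↦ (−a,−b,−c)`. [folklore] -/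
theorem numerator_neg_flip (a b c : ℝ) (e k : ℕ) (x : ℝ) :
    ((e + k + 2 : ℝ) * (-c) * ((k + 1 : ℝ) * x ^ k)) * (-a + -b * x ^ (e + 1) + -c * x ^ (e + k + 2))
        - ((e + 1 : ℝ) * (-b) + (e + k + 2 : ℝ) * (-c) * x ^ (k + 1))
          * (-b * ((e + 1 : ℝ) * x ^ e) + -c * ((e + k + 2 : ℝ) * x ^ (e + k + 1)))
      = ((e + k + 2 : ℝ) * c * ((k + 1 : ℝ) * x ^ k)) * (a + b * x ^ (e + 1) + c * x ^ (e + k + 2))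
        - ((e + 1 : ℝ) * b + (e + k + 2 : ℝ) * c * x ^ (k + 1))
          * (b * ((e + 1 : ℝ) * x ^ e) + c * ((e + k + 2 : ℝ) * x ^ (e + k + 1))) := by
  ring

/-- ★ **Mid-switched incoherent rows are `Ψ`-decreasing** (sign-free): an incoherent no-dip row (`a b < 0`, `a c < 0`) vanishing at `ρ > 0`
beyond its entry horizon (`(q−2p)·bc ≤ q·c²·ρ^{q−p}`), switched at `x > 0` (`c·g(x) > 0`), has `num(x) < 0`. [this file's theorem] -/
theorem numerator_neg_of_midSwitched (a b c : ℝ) (e k : ℕ) (hab : a * b < 0) (hac : a * c < 0) {ρ x : ℝ} (hρ : 0 < ρ)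
    (hx : 0 < x) (hg : a + b * ρ ^ (e + 1) + c * ρ ^ (e + k + 2) = 0)
    (hthr : ((e + k + 2 : ℝ) - 2 * (e + 1 : ℝ)) * (b * c) ≤ (e + k + 2 : ℝ) * c ^ 2 * ρ ^ (k + 1))
    (hsw : 0 < c * (a + b * x ^ (e + 1) + c * x ^ (e + k + 2))) :
    ((e + k + 2 : ℝ) * c * ((k + 1 : ℝ) * x ^ k)) * (a + b * x ^ (e + 1) + c * x ^ (e + k + 2))
        - ((e + 1 : ℝ) * b + (e + k + 2 : ℝ) * c * x ^ (k + 1))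
          * (b * ((e + 1 : ℝ) * x ^ e) + c * ((e + k + 2 : ℝ) * x ^ (e + k + 1))) < 0 := by
  rcases lt_or_gt_of_ne (show a ≠ 0 by rintro rfl; simp at hab) with ha | ha
  · -- `a < 0 < b, c`: flip all signs
    have hb : 0 < b := by nlinarith
    have hc : 0 < c := by nlinarith
    have hg' : -a + -b * ρ ^ (e + 1) + -c * ρ ^ (e + k + 2) = 0 := by linarith
    have hthr' : ((e + k + 2 : ℝ) - 2 * (e + 1 : ℝ)) * (-b * -c) ≤ (e + k + 2 : ℝ) * (-c) ^ 2 * ρ ^ (k + 1) := by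
      simpa only [neg_mul_neg, neg_sq] using hthr
    have hsw' : -a + -b * x ^ (e + 1) + -c * x ^ (e + k + 2) < 0 := by
      have : 0 < a + b * x ^ (e + 1) + c * x ^ (e + k + 2) := pos_of_mul_pos_right hsw hc.le
      linarith
    have h := numerator_neg_of_midSwitched_pos (-a) (-b) (-c) e k (neg_neg_of_pos hb) (neg_neg_of_pos hc) hρ hx hg' hthr' hsw'
    rwa [numerator_neg_flip] at h
  · have hb : b < 0 := by nlinarith
    have hc : c < 0 := by nlinarith
    have hsw' : a + b * x ^ (e + 1) + c * x ^ (e + k + 2) < 0 := by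
      by_contra hge
      have := mul_nonpos_of_nonpos_of_nonneg hc.le (le_of_not_gt hge)
      linarith
    exact numerator_neg_of_midSwitched_pos a b c e k hb hc hρ hx hg hthr hsw'

/-! ### §4 The window law with the raw pointwise hypothesis `num_j < 0` -/

/-- **`Ψ′ < 0` from the raw pointwise hypothesis** (`m ≥ 1`, no factor vanishing at `x`, every `num_j(x) < 0`). [this file's lemma] -/
theorem hasDerivAt_psi_neg_of_num {m : ℕ} (hm : 0 < m) (a b c : Fin m → ℝ) (e k : ℕ) {x : ℝ}
    (hg : ∀ j, a j + b j * x ^ (e + 1) + c j * x ^ (e + k + 2) ≠ 0)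
    (hnum : ∀ j, ((e + k + 2 : ℝ) * c j * ((k + 1 : ℝ) * x ^ k)) * (a j + b j * x ^ (e + 1) + c j * x ^ (e + k + 2))
        - ((e + 1 : ℝ) * b j + (e + k + 2 : ℝ) * c j * x ^ (k + 1))
          * (b j * ((e + 1 : ℝ) * x ^ e) + c j * ((e + k + 2 : ℝ) * x ^ (e + k + 1))) < 0) :
    ∃ D : ℝ, D < 0 ∧ HasDerivAt (fun y : ℝ => ∑ j, ((e + 1 : ℝ) * b j + (e + k + 2 : ℝ) * c j * y ^ (k + 1))
        / (a j + b j * y ^ (e + 1) + c j * y ^ (e + k + 2))) D x := by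
  refine ⟨∑ j, ((((e + k + 2 : ℝ) * c j * ((k + 1 : ℝ) * x ^ k)) * (a j + b j * x ^ (e + 1) + c j * x ^ (e + k + 2))
        - ((e + 1 : ℝ) * b j + (e + k + 2 : ℝ) * c j * x ^ (k + 1))
          * (b j * ((e + 1 : ℝ) * x ^ e) + c j * ((e + k + 2 : ℝ) * x ^ (e + k + 1))))
        / (a j + b j * x ^ (e + 1) + c j * x ^ (e + k + 2)) ^ 2), ?_, ?_⟩
  · refine Finset.sum_neg (fun j _ => ?_) ⟨⟨0, hm⟩, Finset.mem_univ _⟩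
    exact div_neg_of_neg_of_pos (hnum j) (by have h0 := hg j; positivity)
  · exact HasDerivAt.fun_sum (u := Finset.univ) (fun j _ => hasDerivAt_term (a j) (b j) (c j) e k (hg j))

/-- **Rolle for `Ψ` under the raw hypothesis**: on `[w₁,w₂] ⊂ (0,∞)` with no factor vanishing and every `num_j < 0` pointwise, `Ψ` does
not take the same value twice. [this file's lemma] -/
theorem psi_injective_of_num {m : ℕ} (hm : 0 < m) (a b c : Fin m → ℝ) (e k : ℕ) {w₁ w₂ : ℝ} (hw : w₁ < w₂)
    (hfree : ∀ t ∈ Set.Icc w₁ w₂, ∀ j, a j + b j * t ^ (e + 1) + c j * t ^ (e + k + 2) ≠ 0)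
    (hnum : ∀ t ∈ Set.Icc w₁ w₂, ∀ j,
      ((e + k + 2 : ℝ) * c j * ((k + 1 : ℝ) * t ^ k)) * (a j + b j * t ^ (e + 1) + c j * t ^ (e + k + 2))
        - ((e + 1 : ℝ) * b j + (e + k + 2 : ℝ) * c j * t ^ (k + 1))
          * (b j * ((e + 1 : ℝ) * t ^ e) + c j * ((e + k + 2 : ℝ) * t ^ (e + k + 1))) < 0)
    (heq : (∑ j, ((e + 1 : ℝ) * b j + (e + k + 2 : ℝ) * c j * w₁ ^ (k + 1)) / (a j + b j * w₁ ^ (e + 1) + c j * w₁ ^ (e + k + 2)))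
      = ∑ j, ((e + 1 : ℝ) * b j + (e + k + 2 : ℝ) * c j * w₂ ^ (k + 1)) / (a j + b j * w₂ ^ (e + 1) + c j * w₂ ^ (e + k + 2))) :
    False := by
  have hcont : ContinuousOn (fun y : ℝ => ∑ j, ((e + 1 : ℝ) * b j + (e + k + 2 : ℝ) * c j * y ^ (k + 1))
      / (a j + b j * y ^ (e + 1) + c j * y ^ (e + k + 2))) (Set.Icc w₁ w₂) := by
    intro t ht
    obtain ⟨D, _, hD⟩ := hasDerivAt_psi_neg_of_num hm a b c e k (hfree t ht) (hnum t ht)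
    exact hD.continuousAt.continuousWithinAt
  obtain ⟨ξ, hξ, hξ'⟩ := exists_deriv_eq_zero hw hcont heq
  obtain ⟨D, hDneg, hD⟩ := hasDerivAt_psi_neg_of_num hm a b c e k
    (hfree ξ ⟨hξ.1.le, hξ.2.le⟩) (hnum ξ ⟨hξ.1.le, hξ.2.le⟩)
  rw [hD.deriv] at hξ'
  exact hDneg.ne hξ'

/-- **Window law, raw form**: `X·P′` (`P = ∏` of the chart trinomials) has no two zeros `w₁ < w₂` in `(0,∞)` with `[w₁,w₂]` free of the
factors' zeros and every `num_j < 0` on it. [this file's theorem] -/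
theorem X_mul_derivative_no_two_zeros_of_num {m : ℕ} (hm : 0 < m) (a b c : Fin m → ℝ) (e k : ℕ) {w₁ w₂ : ℝ}
    (hw₁ : 0 < w₁) (hw : w₁ < w₂)
    (hfree : ∀ t ∈ Set.Icc w₁ w₂, ∀ j, a j + b j * t ^ (e + 1) + c j * t ^ (e + k + 2) ≠ 0)
    (hnum : ∀ t ∈ Set.Icc w₁ w₂, ∀ j,
      ((e + k + 2 : ℝ) * c j * ((k + 1 : ℝ) * t ^ k)) * (a j + b j * t ^ (e + 1) + c j * t ^ (e + k + 2))
        - ((e + 1 : ℝ) * b j + (e + k + 2 : ℝ) * c j * t ^ (k + 1))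
          * (b j * ((e + 1 : ℝ) * t ^ e) + c j * ((e + k + 2 : ℝ) * t ^ (e + k + 1))) < 0)
    (h1 : eval w₁ (X * derivative (∏ j, (C (a j) + C (b j) * X ^ (e + 1) + C (c j) * X ^ (e + k + 2)))) = 0)
    (h2 : eval w₂ (X * derivative (∏ j, (C (a j) + C (b j) * X ^ (e + 1) + C (c j) * X ^ (e + k + 2)))) = 0) : False :=
  psi_injective_of_num hm a b c e k hw hfree hnum
    ((psi_eq_zero_of_eval_X_mul_derivative a b c e k hw₁ (hfree w₁ ⟨le_rfl, hw.le⟩) h1).trans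
      (psi_eq_zero_of_eval_X_mul_derivative a b c e k (hw₁.trans hw) (hfree w₂ ⟨hw.le, le_rfl⟩) h2).symm)

/-! ### §5 The mid-switching sector is linear at every ratio -/

/-- ★★ **THE MID-SWITCHING SECTOR IS LINEAR AT EVERY RATIO.**  `K = 3`, bottom coupling, ANY support `d 0 < d 1 < d 2`, any `m`; a no-dip
company (`a_{j0} a_{j2} < 0`) in which every INCOHERENT row (`a_{j0} a_{j1} < 0`) is unswitched below its entry horizon:
`(d₂−d₀)·a_{j2}²·x^{d₂−d₁} < (d₂−d₀−2(d₁−d₀))·a_{j1}a_{j2} ⇒ a_{j2}·f_j(x) < 0` (`x > 0`).  Then `Z₊(eulerNumerator d a 0) ≤ 2m + 1`.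
[this file's theorem] -/
theorem eulerBound_midSwitching {m : ℕ} (d : Fin 3 → ℕ) (h01 : d 0 < d 1) (h12 : d 1 < d 2)
    (a : Fin m → Fin 3 → ℝ) (hac : ∀ j, a j 0 * a j 2 < 0)
    (hmid : ∀ j, a j 0 * a j 1 < 0 → ∀ x : ℝ, 0 < x →
      ((d 2 : ℝ) - d 0) * a j 2 ^ 2 * x ^ (d 2 - d 1) < (((d 2 : ℝ) - d 0) - 2 * ((d 1 : ℝ) - d 0)) * (a j 1 * a j 2) →
      a j 2 * (∑ l, C (a j l) * X ^ (d l) : ℝ[X]).eval x < 0) :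
    ((∑ j, (∑ l, C (a j l * ((d l : ℝ) - d 0)) * X ^ (d l)) * ∏ i ∈ Finset.univ.erase j, (∑ l, C (a i l) * X ^ (d l))
        : ℝ[X]).roots.toFinset.filter (fun t => 0 < t)).card ≤ 2 * m + 1 := by
  classical
  rcases Nat.eq_zero_or_pos m with hm | hm
  · subst hm
    simp only [Finset.univ_eq_empty, Finset.sum_empty, roots_zero, Multiset.toFinset_zero, Finset.filter_empty,
      Finset.card_empty]
    exact Nat.zero_le _
  obtain ⟨e, he⟩ : ∃ e, d 1 = d 0 + e + 1 := ⟨d 1 - d 0 - 1, by omega⟩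
  obtain ⟨k, hk⟩ : ∃ k, d 2 = d 0 + e + k + 2 := ⟨d 2 - d 1 - 1, by omega⟩
  have hk1 : d 2 - d 1 = k + 1 := by omega
  have hp : ((d 1 : ℝ) - d 0) = (e + 1 : ℝ) := by rw [he]; push_cast; ring
  have hq : ((d 2 : ℝ) - d 0) = (e + k + 2 : ℝ) := by rw [hk]; push_cast; ring
  rw [eulerNumerator_eq d e k he hk a 0, sub_self, mul_zero, map_zero, zero_mul, sub_zero, card_pos_roots_X_pow_mul]
  set P : ℝ[X] := ∏ j, (C (a j 0) + C (a j 1) * X ^ (e + 1) + C (a j 2) * X ^ (e + k + 2)) with hPdef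
  have hac' : ∀ j, a j 0 * a j 2 < 0 := hac
  have hP0 : P ≠ 0 := prod_trinomial_ne_zero (fun j => a j 0) (fun j => a j 1) (fun j => a j 2) e k hac'
  have hZ := prod_trinomial_pos_roots_le (fun j => a j 0) (fun j => a j 1) (fun j => a j 2) e k hac'
  -- chart form of the hypothesis: below the entry horizon an incoherent row is unswitched
  have hmid' : ∀ j, a j 0 * a j 1 < 0 → ∀ x : ℝ, 0 < x →
      (e + k + 2 : ℝ) * a j 2 ^ 2 * x ^ (k + 1) < ((e + k + 2 : ℝ) - 2 * (e + 1 : ℝ)) * (a j 1 * a j 2) →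
      a j 2 * (a j 0 + a j 1 * x ^ (e + 1) + a j 2 * x ^ (e + k + 2)) < 0 := by
    intro j hab x hx hlt
    have h := hmid j hab x hx (by rw [hp, hq, hk1]; exact hlt)
    rw [eval_row_eq_pow_mul d e k he hk (a j) x, mul_left_comm] at h
    exact neg_of_mul_neg_right h (pow_pos hx _).le
  -- pointwise `num_j < 0` at every zero-free point `t > 0`
  have hrow : ∀ t : ℝ, 0 < t → ∀ j, a j 0 + a j 1 * t ^ (e + 1) + a j 2 * t ^ (e + k + 2) ≠ 0 →
      ((e + k + 2 : ℝ) * a j 2 * ((k + 1 : ℝ) * t ^ k)) * (a j 0 + a j 1 * t ^ (e + 1) + a j 2 * t ^ (e + k + 2))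
        - ((e + 1 : ℝ) * a j 1 + (e + k + 2 : ℝ) * a j 2 * t ^ (k + 1))
          * (a j 1 * ((e + 1 : ℝ) * t ^ e) + a j 2 * ((e + k + 2 : ℝ) * t ^ (e + k + 1))) < 0 := by
    intro t ht j hgt
    rcases le_or_gt 0 (a j 0 * a j 1) with hab | hab
    · exact numerator_neg_of_coherent_any (a j 0) (a j 1) (a j 2) e k (hac' j) hab ht
    · rcases lt_or_gt_of_ne (show a j 2 * (a j 0 + a j 1 * t ^ (e + 1) + a j 2 * t ^ (e + k + 2)) ≠ 0 from
          mul_ne_zero (by intro h0; have := hac' j; rw [h0, mul_zero] at this; exact lt_irrefl 0 this) hgt) with hun | hsw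
      · exact numerator_neg_of_unswitched (a j 0) (a j 1) (a j 2) e k ht hun
      · -- switched at `t`: the row has a zero `ρ ∈ (0, t)` (IVT), necessarily beyond the entry horizon
        have hcont : ContinuousOn (fun y : ℝ => a j 2 * (a j 0 + a j 1 * y ^ (e + 1) + a j 2 * y ^ (e + k + 2)))
            (Set.Icc 0 t) := by fun_prop
        have hz1 : (0 : ℝ) ^ (e + 1) = 0 := zero_pow (by omega)
        have hz2 : (0 : ℝ) ^ (e + k + 2) = 0 := zero_pow (by omega)
        have h0 : a j 2 * (a j 0 + a j 1 * (0 : ℝ) ^ (e + 1) + a j 2 * (0 : ℝ) ^ (e + k + 2)) < 0 := by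
          rw [hz1, hz2, mul_zero, mul_zero, add_zero, add_zero, mul_comm]
          exact hac' j
        obtain ⟨ρ, hρmem, hρ0⟩ := intermediate_value_Icc ht.le hcont (show (0 : ℝ) ∈ Set.Icc _ _ from ⟨h0.le, hsw.le⟩)
        have hc0 : a j 2 ≠ 0 := by intro h0'; have := hac' j; rw [h0', mul_zero] at this; exact lt_irrefl 0 this
        have hgρ : a j 0 + a j 1 * ρ ^ (e + 1) + a j 2 * ρ ^ (e + k + 2) = 0 :=
          (mul_eq_zero.mp hρ0).resolve_left hc0
        have hρpos : 0 < ρ := by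
          rcases eq_or_lt_of_le hρmem.1 with h | h
          · exfalso
            rw [← h, hz1, hz2, mul_zero, mul_zero, add_zero, add_zero] at hgρ
            have := hac' j; rw [hgρ, zero_mul] at this; exact lt_irrefl 0 this
          · exact h
        have hthr : ((e + k + 2 : ℝ) - 2 * (e + 1 : ℝ)) * (a j 1 * a j 2) ≤ (e + k + 2 : ℝ) * a j 2 ^ 2 * ρ ^ (k + 1) := by
          by_contra hlt
          have := hmid' j hab ρ hρpos (lt_of_not_ge hlt)
          rw [hgρ, mul_zero] at this
          exact lt_irrefl 0 this
        exact numerator_neg_of_midSwitched (a j 0) (a j 1) (a j 2) e k hab (hac' j) hρpos ht hgρ hthr hsw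
  have h := roots_filter_le_of_windowLaw P (X * derivative P) hP0 (fun t => 0 < t)
    (fun z₁ _ t h₁ _ h₂ _ => h₁.trans_le h₂) m hZ (fun w₁ w₂ hw₁ _ hw hfree h1 h2 => ?_)
  · exact h.trans (by omega)
  · have hfree' : ∀ t ∈ Set.Icc w₁ w₂, ∀ j, a j 0 + a j 1 * t ^ (e + 1) + a j 2 * t ^ (e + k + 2) ≠ 0 := by
      intro t ht j hj
      apply hfree t ht
      rw [hPdef, eval_prod_trinomial, Finset.prod_eq_zero_iff]
      exact ⟨j, mem_univ _, hj⟩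
    exact X_mul_derivative_no_two_zeros_of_num hm (fun j => a j 0) (fun j => a j 1) (fun j => a j 2) e k hw₁ hw hfree'
      (fun t ht j => hrow t (hw₁.trans_le ht.1) j (hfree' t ht j)) h1 h2

/-- **The mid-switching sector in MEMBER currency:** every member `c·X^{m d 0} + ∏_j f_j` has at most `2m + 2` positive zeros
(✓ `card_pos_roots_class_le_euler`). [this file's theorem] -/
theorem midSwitching_sector_class {m : ℕ} (d : Fin 3 → ℕ) (h01 : d 0 < d 1) (h12 : d 1 < d 2)
    (a : Fin m → Fin 3 → ℝ) (hac : ∀ j, a j 0 * a j 2 < 0)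
    (hmid : ∀ j, a j 0 * a j 1 < 0 → ∀ x : ℝ, 0 < x →
      ((d 2 : ℝ) - d 0) * a j 2 ^ 2 * x ^ (d 2 - d 1) < (((d 2 : ℝ) - d 0) - 2 * ((d 1 : ℝ) - d 0)) * (a j 1 * a j 2) →
      a j 2 * (∑ l, C (a j l) * X ^ (d l) : ℝ[X]).eval x < 0) (c : ℝ) :
    ((C c * X ^ (m * d 0) + ∏ j, (∑ l, C (a j l) * X ^ (d l)) : ℝ[X]).roots.toFinset.filter (fun t => 0 < t)).card
      ≤ 2 * m + 2 := by
  have h1 := card_pos_roots_class_le_euler d a 0 c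
  have h2 := eulerBound_midSwitching d h01 h12 a hac hmid
  omega

end ProductPlusOne

end Summit.ValiantsHypothesis.ValiantsHypothesis.Theorems.LacunarySymmetroidMatrixDescartes
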